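import Summits.Langlands.Langlands.Theses.PhantomRMYoshida
import Summits.Langlands.Langlands.Theorems.PhantomRMYoshidaFaltingsFinitenessIKerGeomTorsion
import Summits.Langlands.Langlands.Theorems.PhantomRMYoshidaFaltingsFinitenessIGeomQuotient
import Literature.NumberTheory.DiophantineGeometry.AVGaloisModuleContinuityProofs
import HarnessLib

/-!
# Route PhantomRMYoshida — FaltingsFinitenessI (item stmt-Langlands-15084): Finiteness I from the minimal-isogeny bound

Line `Sketch` of the crux (card `isogeny-degree-bound`), the composition step, sorry-free:
**Faltings' Finiteness I follows from a bound on the degree of a connecting isogeny, by counting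
geometric kernels** — over any field of characteristic `0`.

Let `A / K`, `char K = 0`, and suppose every `B` admitting an isogeny `B → A` is the target of an
isogeny `g_B : A → B` with `deg g_B = kerRank g_B ≤ N`. Put `M = N!`. Then

* `Ker g_B(K̄) ⊆ A[M](K̄)` — the geometric kernel of an isogeny is killed by its degree
  (`ker_geomPointsMap_le_geomTorsion`, Deligne's theorem, file `…KerGeomTorsion`), and
  `deg g_B ∣ M`;
* `A[M](K̄)` is finite (`finite_geomTorsion_of_cast_ne_zero`);
* two isogenies out of `A` with the same geometric kernel have isomorphic targets
  (`nonempty_iso_of_ker_geomPointsMap_eq`): in characteristic `0` an isogeny is the quotient by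
  its geometric kernel (`exists_comp_eq_of_ker_geomPointsMap_le`, file `…GeomQuotient`, through
  the étale isogeny `[deg g]` and Milne 1986 Lemma 12.6 — no appeal to Cartier's theorem), and
  isogenies are epimorphisms (`nonempty_iso_of_comp_eq`).

Hence `B ↦ Ker g_B(K̄)` injects the isomorphism classes of such `B` into the power set of the
finite set `A[M](K̄)` (`exists_isoClasses_of_isogeny_kerRank_le`, pigeonhole
`exists_fin_family_of_finite_range`) — the step "bound the degree, then count the finite
subgroups" of the transcendence proof of Finiteness I (Masser–Wüstholz 1993/1995; Baker–Wüstholz,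
*Logarithmic Forms and Diophantine Geometry* (2007), §7.4, p. 165).

Consequence for the item: `faltingsFinitenessI_of_isogenyKernelBound` — the route decl
`FaltingsFinitenessI` (Finiteness I over `ℚ`, item stmt-Langlands-15084) from the isogeny-kernel
bound over `ℚ` (the line's registered stub `stub_isogenyKernelBound`, the Masser–Wüstholz isogeny
theorem at `K = ℚ`), i.e. the line's composition `FaltingsFinitenessI_of` with its one open stub as
hypothesis; registered stub name `stub_faltingsFinitenessI_of_isogenyKernelBound`.

What is NOT here: the isogeny bound itself (Masser–Wüstholz, Publ. Math. IHÉS 81 (1995), Thm. II: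
period theorem, Faltings height, Zarhin's trick — absent from Mathlib and the tree), which the
sibling file `…FaltingsFinitenessIOfMasserWustholz` takes as a named fact. Pure-proof file.
-/

set_option linter.dupNamespace false -- as in the sibling Theorems files: `Summit.Langlands.Langlands` is the mandated namespace (summit = sub-problem)

noncomputable section

open CategoryTheory
open Literature.AlgebraicGeometry.Motives
open Literature.AlgebraicGeometry.Motives.AbelianVariety

universe u

namespace Summit.Langlands.Langlands.Theorems.PhantomRMYoshida

/-! ### Glue -/

/-- Geometric torsion subgroups are monotone in divisibility: `m ∣ n → A[m](K̄) ≤ A[n](K̄)`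
(`(k m) • P = k • (m • P)`). [folklore] -/
theorem geomTorsion_mono {K : Type u} [Field K] (A : AbelianVariety K) {m n : ℤ} (h : m ∣ n) :
    A.geomTorsion m ≤ A.geomTorsion n := by
  intro P hP
  obtain ⟨k, rfl⟩ := h
  rw [mem_geomTorsion_iff'] at hP ⊢
  rw [mul_comm, mul_smul, hP, smul_zero]

/-- Two isogenies out of `A` that factor through each other have isomorphic targets: the two
factorisations are mutually inverse because isogenies are epimorphisms among homomorphisms
(`IsIsogeny.cancel_left`, Görtz–Wedhorn II Prop. 27.178 (1)). [folklore] -/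
theorem nonempty_iso_of_comp_eq {K : Type u} [Field K] {A B C : AbelianVariety K}
    {g : A ⟶ B} {g' : A ⟶ C} (hg : IsIsogeny g) (hg' : IsIsogeny g')
    {χ : B ⟶ C} {χ' : C ⟶ B} (h₁ : g ≫ χ = g') (h₂ : g' ≫ χ' = g) : Nonempty (B ≅ C) := by
  refine ⟨⟨χ, χ', hg.cancel_left ?_, hg'.cancel_left ?_⟩⟩
  · rw [← Category.assoc, h₁, h₂, Category.comp_id]
  · rw [← Category.assoc, h₂, h₁, Category.comp_id]

/-- **Same geometric kernel, isomorphic quotients** (characteristic `0`): two isogenies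
`g : A → B`, `g' : A → C` with `Ker g(K̄) = Ker g'(K̄)` have `B ≅ C` — each factors through the
other by `exists_comp_eq_of_ker_geomPointsMap_le` (an isogeny is the quotient by its geometric
kernel, Milne 1986 §8 with Lemma 12.6), and `nonempty_iso_of_comp_eq`. [folklore] -/
theorem nonempty_iso_of_ker_geomPointsMap_eq {K : Type u} [Field K] [CharZero K]
    {A B C : AbelianVariety K} {g : A ⟶ B} {g' : A ⟶ C} (hg : IsIsogeny g) (hg' : IsIsogeny g')
    (h : (Hom.geomPointsMap g).ker = (Hom.geomPointsMap g').ker) : Nonempty (B ≅ C) := by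
  obtain ⟨χ, hχ⟩ := exists_comp_eq_of_ker_geomPointsMap_le hg g' h.le
  obtain ⟨χ', hχ'⟩ := exists_comp_eq_of_ker_geomPointsMap_le hg' g h.ge
  exact nonempty_iso_of_comp_eq hg hg' hχ hχ'

/-- Pigeonhole bookkeeping: an invariant `inv` on `{i // P i}` with finite range, whose equality
implies the relation `R`, yields finitely many `R`-representatives `C : Fin n → ι` of the `i` with
`P i` (representatives chosen by `Set.rangeSplitting`). [folklore] -/
theorem exists_fin_family_of_finite_range {ι X : Type*} (P : ι → Prop) (inv : {i // P i} → X)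
    (hfin : (Set.range inv).Finite) (R : ι → ι → Prop)
    (hR : ∀ i j : {i // P i}, inv i = inv j → R i j) :
    ∃ (n : ℕ) (C : Fin n → ι), ∀ i, P i → ∃ k, R i (C k) := by
  haveI : Finite (Set.range inv) := hfin
  obtain ⟨n, ⟨e⟩⟩ := Finite.exists_equiv_fin (Set.range inv)
  refine ⟨n, fun k => (Set.rangeSplitting inv (e.symm k)).1, fun i hi => ?_⟩
  refine ⟨e ⟨inv ⟨i, hi⟩, Set.mem_range_self _⟩, hR ⟨i, hi⟩ _ ?_⟩
  rw [Equiv.symm_apply_apply]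
  exact (Set.apply_rangeSplitting inv ⟨inv ⟨i, hi⟩, Set.mem_range_self _⟩).symm

/-! ### The counting reduction -/

/-- **Finiteness of isomorphism classes from an isogeny-degree bound** (characteristic `0`): if
every abelian variety `B` admitting an isogeny `B → A` is the target of an isogeny `A → B` of
degree (`Hom.kerRank`) at most `N`, then up to isomorphism only finitely many `B` admit an isogeny
`B → A`. Proof: choose such `g_B` for each `B`; with `M = N!`, `Ker g_B(K̄) ≤ A[M](K̄)`
(`ker_geomPointsMap_le_geomTorsion`: the kernel is killed by `deg g_B`, which divides `M`), a
finite group (`finite_geomTorsion_of_cast_ne_zero`); and `B ↦ Ker g_B(K̄) ⊆ A[M](K̄)` is injective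
on isomorphism classes (`nonempty_iso_of_ker_geomPointsMap_eq`). This is the step "bound the
degree, then count the finite subgroups" of the transcendence proof of Finiteness I
(Baker–Wüstholz 2007, §7.4, p. 165). [folklore] -/
theorem exists_isoClasses_of_isogeny_kerRank_le {K : Type u} [Field K] [CharZero K]
    (A : AbelianVariety K) {N : ℕ}
    (hN : ∀ B : AbelianVariety K, IsIsogenous B A → ∃ g : A ⟶ B, IsIsogeny g ∧ Hom.kerRank g ≤ N) :
    ∃ (n : ℕ) (C : Fin n → AbelianVariety K),
      ∀ B : AbelianVariety K, IsIsogenous B A → ∃ i, Nonempty (B ≅ C i) := by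
  -- one isogeny of bounded degree onto each `B` isogenous to `A`
  choose g hg hgN using fun B : {B : AbelianVariety K // IsIsogenous B A} => hN B.1 B.2
  -- `M = N!` kills every kernel; `A[M](K̄)` is finite
  set M : ℕ := N.factorial with hM
  have hM0 : ((M : ℤ) : K) ≠ 0 := by exact_mod_cast (Nat.factorial_pos N).ne'
  haveI : Finite (A.geomTorsion (M : ℤ)) := finite_geomTorsion_of_cast_ne_zero A (M : ℤ) hM0
  have hker : ∀ B, (Hom.geomPointsMap (g B)).ker ≤ A.geomTorsion (M : ℤ) := fun B =>
    (ker_geomPointsMap_le_geomTorsion (hg B)).trans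
      (geomTorsion_mono A (Int.natCast_dvd_natCast.2
        (Nat.dvd_factorial (by haveI := (hg B).2; exact Hom.kerRank_pos (g B)) (hgN B))))
  -- the invariant: the geometric kernel, as a subset of `A[M](K̄)`
  let inv : {B : AbelianVariety K // IsIsogenous B A} → Set (A.geomTorsion (M : ℤ)) :=
    fun B => {P | (P : A.geomPoints) ∈ (Hom.geomPointsMap (g B)).ker}
  refine exists_fin_family_of_finite_range (fun B : AbelianVariety K => IsIsogenous B A) inv
    (Set.toFinite _) (fun B C => Nonempty (B ≅ C)) fun B C hBC => ?_
  -- equal invariants ⇒ equal geometric kernels ⇒ isomorphic targets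
  refine nonempty_iso_of_ker_geomPointsMap_eq (hg B) (hg C) (le_antisymm ?_ ?_)
  · intro P hP
    have hP' : (⟨P, hker B hP⟩ : A.geomTorsion (M : ℤ)) ∈ inv B := hP
    rw [hBC] at hP'
    exact hP'
  · intro P hP
    have hP' : (⟨P, hker C hP⟩ : A.geomTorsion (M : ℤ)) ∈ inv C := hP
    rw [← hBC] at hP'
    exact hP'

/-! ### Consequences for the item and for the Literature fact -/

/-- **The line's composition with its open stub as hypothesis**: the route decl
`FaltingsFinitenessI` (Faltings' Finiteness I over `ℚ`, item stmt-Langlands-15084) follows from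
the isogeny-kernel bound over `ℚ` — verbatim the registered stub `stub_isogenyKernelBound` of line
`Sketch` — by `exists_isoClasses_of_isogeny_kerRank_le`. [folklore] -/
theorem faltingsFinitenessI_of_isogenyKernelBound
    (h : ∀ A : AbelianVariety ℚ, ∃ N : ℕ, ∀ B : AbelianVariety ℚ, IsIsogenous B A →
      ∃ g : A ⟶ B, IsIsogeny g ∧ Hom.kerRank g ≤ N) :
    Summit.Langlands.Langlands.Theses.PhantomRMYoshida.FaltingsFinitenessI := by
  intro A
  obtain ⟨N, hN⟩ := h A
  exact exists_isoClasses_of_isogeny_kerRank_le A hN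

/-- The registered stub `stub_faltingsFinitenessI_of_isogenyKernelBound` of line `Sketch` (the
counting reduction P1 of card `isogeny-degree-bound`), by `faltingsFinitenessI_of_isogenyKernelBound`.
[folklore] -/
theorem stub_faltingsFinitenessI_of_isogenyKernelBound
    (h : ∀ A : AbelianVariety ℚ, ∃ N : ℕ, ∀ B : AbelianVariety ℚ, IsIsogenous B A →
      ∃ g : A ⟶ B, IsIsogeny g ∧ Hom.kerRank g ≤ N) :
    Summit.Langlands.Langlands.Theses.PhantomRMYoshida.FaltingsFinitenessI :=
  faltingsFinitenessI_of_isogenyKernelBound h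

end Summit.Langlands.Langlands.Theorems.PhantomRMYoshida

end
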